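import Summits.Ventures.Crystal3D.Theorems.StickyWulffConstantCoaxialWallLawOneFccLayerSums
import Summits.Ventures.Crystal3D.Theorems.StickyWulffConstantCoaxialWallLawEndRowDefs
import Summits.Ventures.Crystal3D.Theorems.StickyWulffConstantTextureLiminfTexShadowCertificateDefs
import Summits.Ventures.Crystal3D.Theorems.StickyWulffConstantGenericWallFloorShellCount
import Summits.Ventures.Crystal3D.Theorems.StickyWulffConstantGenericWallFloorMixedDozenRules
import Literature.Algebra.EuclideanLattices.FccBccLattices
import HarnessLib

/-!
# The ONE-FCC F_layer: FLUX BOUNDS on the faulted plate — A-sources from below, B-exits from above (file (h) of the two-family ledger)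

HONEST FRAMING. Venture `Summits/Ventures/Crystal3D` (cell `crystal3d-full`); helper `--supports` the crux `CoaxialWallLaw`
(stmt-Ventures-19481, REGISTERED line `WallLedgerF`) in its role as owner of lane T's debt T-F2 / F_layer, OneFcc half (cf-p1 (civ)/(cxx);
memo HOME/wall-19481-p1/g16/TWO-FAMILY-LEDGER-g16.md §Ledger (I1), (I3)).  Lattice-line counting only (`plate_tops_ge` /
`plate_firstAbove_le`, …OneFccLayerSums); census-free, standard axioms; nothing about the crux is claimed; F-C1 not moved.

* **`oneFcc_srcA_ge`** — (I1): the A-admissible core balls of the faulted bottom plate `stacking L₁ s₁ σ₁` crossing height `−R₀−2` along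
  the rising in-plane roots of `Fr` (`Fr r = L₁ r` on basal `r`) number at least `Σ_{k ∈ K, k admissible} (Φ·G_k − #RT)`,
  `Φ = 4 (Σ_r (Fr r)₂)/(√3 S²)`, `G_k = √(((ρ−4)² S² − x_k²)₊)`, `x_k = k d + (L₁⁻¹ s₁)₂ + (R₀+2) ν₂`, for ANY finite layer set `K`.
* **`oneFcc_exitB_le`** — (I3): in the mirrored cell, the top-band balls of the plate `stacking L' s' σ₁` on layers of type `≠ (t,t)` whose
  `r`-predecessor (`FrB r = −L' r` on basal `r`) lies below the band number at most `Σ_{k ∈ K, k of exit type} (Φ·G_k + #RT) + #RT · 144 ρ`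
  once `K` holds every layer index met by `X'` (the lateral annulus `(ρ−5, ρ−3]` is `≤ 144 ρ` balls by the shell count).
WHAT THIS IS NOT: the B-sources (file (i)), the charge, the assembly; F-C1 not moved.
-/

noncomputable section

namespace Summit.Ventures.Crystal3D.Theorems

open Summit.Ventures.Crystal3D Finset
open Literature.MathematicalPhysics.StatisticalMechanics (barlowPos barlowStacking barlowPos_mem barlowPos_apply_two)
open Summit.Ventures.Crystal3D.Cruxes.TextureLiminf.TexShadow (E3 stacking)
open scoped InnerProductSpace

/-- A coordinate of a slot image is at most `1`. -/
theorem apply_two_le_one_of_slot (G : E3 ≃ₗᵢ[ℝ] E3) {r : E3} (hr : r ∈ fccSlots) : (G r) 2 ≤ 1 := by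
  have h1 : ‖G r‖ = 1 := by rw [LinearIsometryEquiv.norm_map]; exact norm_eq_one_of_mem_fccSlots hr
  have h2 := Literature.Algebra.EuclideanLattices.norm_sq_fin_three (G r)
  rw [h1] at h2
  nlinarith [sq_nonneg ((G r) 0), sq_nonneg ((G r) 1), sq_nonneg ((G r) 2 - 1)]

open scoped Classical in
/-- **(I1) A-SOURCES FROM BELOW.**  See the module docstring. -/
theorem oneFcc_srcA_ge {σ₁ : ℤ → ℤ} (L₁ : E3 ≃ₗᵢ[ℝ] E3) (s₁ : E3) (Fr : E3 ≃ₗᵢ[ℝ] E3)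
    (hFrr : ∀ r : E3, r 2 = 0 → Fr r = L₁ r) (t : ℤ)
    (P₁ : Finset E3) (R₀ h ρ : ℝ) (hR₀ : 3 ≤ R₀) (hh : 0 ≤ h) (hρ : 4 ≤ ρ)
    (hP₁ : ∀ p, p ∈ P₁ ↔ (p ∈ stacking L₁ s₁ σ₁ ∧ -(2 * R₀) ≤ p 2 ∧ p 2 ≤ -R₀ ∧ p 0 ^ 2 + p 1 ^ 2 ≤ ρ ^ 2))
    (Kw : Finset ℤ) :
    ∑ k ∈ Kw, (if ¬ (σ₁ (k - 1) = -t ∧ σ₁ k = -t) then (1 : ℝ) else 0) *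
        (4 * (∑ r ∈ inPlaneRoots Fr 1, (Fr r) 2) / (Real.sqrt 3 * (1 - (L₁.symm (EuclideanSpace.single (2 : Fin 3) (1 : ℝ))) 2 ^ 2)) *
          Real.sqrt (max 0 ((ρ - 4) ^ 2 * (1 - (L₁.symm (EuclideanSpace.single (2 : Fin 3) (1 : ℝ))) 2 ^ 2) -
            ((k : ℝ) * Real.sqrt (2 / 3) + (L₁.symm s₁) 2 -
              (-(R₀ + 1) - 1) * (L₁.symm (EuclideanSpace.single (2 : Fin 3) (1 : ℝ))) 2) ^ 2)) -
          ((inPlaneRoots Fr 1).card : ℝ)) ≤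
      ((∑ r ∈ inPlaneRoots Fr 1,
        ((P₁.filter fun p => -(R₀ + 1) - 1 - 1 ≤ p 2 ∧ p 2 ≤ -(R₀ + 1) - 1 ∧ p 0 ^ 2 + p 1 ^ 2 ≤ (ρ - 1 - 1) ^ 2).filter
          fun p => (∃ k i j : ℤ, p = L₁ (barlowPos 1 (Real.sqrt (2 / 3)) σ₁ k i j) + s₁ ∧ ¬ (σ₁ (k - 1) = -t ∧ σ₁ k = -t)) ∧
            -(R₀ + 1) - 1 < (p + Fr r) 2 ∧ (p + Fr r) 2 < h + (R₀ + 1) + 1).card : ℕ) : ℝ) := by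
  set RT := inPlaneRoots Fr 1 with hRT
  set ν₂ : ℝ := (L₁.symm (EuclideanSpace.single (2 : Fin 3) (1 : ℝ))) 2 with hν₂
  set S2 : ℝ := 1 - ν₂ ^ 2 with hS2
  set z₀ : ℝ := -(R₀ + 1) - 1 with hz₀
  set K := Kw.filter (fun k => ¬ (σ₁ (k - 1) = -t ∧ σ₁ k = -t)) with hK
  set P := P₁.filter (fun p => -(R₀ + 1) - 1 - 1 ≤ p 2 ∧ p 2 ≤ -(R₀ + 1) - 1 ∧ p 0 ^ 2 + p 1 ^ 2 ≤ (ρ - 1 - 1) ^ 2) with hP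
  set G : ℤ → ℝ := fun k => Real.sqrt (max 0 ((ρ - 4) ^ 2 * S2 - ((k : ℝ) * Real.sqrt (2 / 3) + (L₁.symm s₁) 2 - z₀ * ν₂) ^ 2))
    with hG
  have hRT : ∀ r ∈ RT, r ∈ fccSlots ∧ r 2 = 0 ∧ 0 < (L₁ r) 2 ∧ Fr r = L₁ r := by
    intro r hr
    obtain ⟨hrS, hr2, hup⟩ := mem_filter.1 hr
    rw [one_mul, hFrr r hr2] at hup
    exact ⟨hrS, hr2, hup, hFrr r hr2⟩
  -- per root: the plate tops
  have hroot : ∀ r ∈ RT, ∑ k ∈ K, (4 * (Fr r) 2 * G k / (Real.sqrt 3 * S2) - 1) ≤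
      (((P₁.filter fun p => -(R₀ + 1) - 1 - 1 ≤ p 2 ∧ p 2 ≤ -(R₀ + 1) - 1 ∧ p 0 ^ 2 + p 1 ^ 2 ≤ (ρ - 1 - 1) ^ 2).filter
          fun p => (∃ k i j : ℤ, p = L₁ (barlowPos 1 (Real.sqrt (2 / 3)) σ₁ k i j) + s₁ ∧ ¬ (σ₁ (k - 1) = -t ∧ σ₁ k = -t)) ∧
            -(R₀ + 1) - 1 < (p + Fr r) 2 ∧ (p + Fr r) 2 < h + (R₀ + 1) + 1).card : ℝ) := by
    intro r hr
    obtain ⟨hrS, hr2, ha, hFr⟩ := hRT r hr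
    have hPin : ∀ k ∈ K, ∀ i j : ℤ, z₀ - 1 < (L₁ (barlowPos 1 (Real.sqrt (2 / 3)) σ₁ k i j) + s₁) 2 →
        (L₁ (barlowPos 1 (Real.sqrt (2 / 3)) σ₁ k i j) + s₁) 2 ≤ z₀ →
        (L₁ (barlowPos 1 (Real.sqrt (2 / 3)) σ₁ k i j) + s₁) 0 ^ 2 + (L₁ (barlowPos 1 (Real.sqrt (2 / 3)) σ₁ k i j) + s₁) 1 ^ 2 ≤
          (ρ - 4 + 1) ^ 2 →
        L₁ (barlowPos 1 (Real.sqrt (2 / 3)) σ₁ k i j) + s₁ ∈ P := by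
      intro k _ i j h1 h2 h3
      have hlat : (L₁ (barlowPos 1 (Real.sqrt (2 / 3)) σ₁ k i j) + s₁) 0 ^ 2 +
          (L₁ (barlowPos 1 (Real.sqrt (2 / 3)) σ₁ k i j) + s₁) 1 ^ 2 ≤ (ρ - 1 - 1) ^ 2 := h3.trans (by nlinarith)
      refine mem_filter.2 ⟨(hP₁ _).2 ⟨⟨_, barlowPos_mem _ _ _, rfl⟩, by linarith, by linarith, hlat.trans (by nlinarith)⟩,
        by linarith, h2, hlat⟩
    have h := plate_tops_ge σ₁ L₁ s₁ hrS hr2 ha z₀ (ρ - 4) (by linarith) K P hPin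
    refine le_trans (le_of_eq (Finset.sum_congr rfl fun k _ => by rw [hFr])) (h.trans ?_)
    refine Nat.cast_le.2 (card_le_card fun p hp => ?_)
    obtain ⟨hpP, ⟨k, hkK, i, j, hpk⟩, hp2, hcross⟩ := mem_filter.1 hp
    have hadm : ¬ (σ₁ (k - 1) = -t ∧ σ₁ k = -t) := (mem_filter.1 hkK).2
    have hp2' : p 2 ≤ -(R₀ + 1) - 1 := (mem_filter.1 hpP).2.2.1
    have hFr2 : (Fr r) 2 ≤ 1 := apply_two_le_one_of_slot Fr hrS
    refine mem_filter.2 ⟨hpP, ⟨k, i, j, hpk, hadm⟩, by rw [hFr]; exact hcross, ?_⟩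
    rw [PiLp.add_apply]; linarith
  -- sum over the roots, exchange, collect
  have hsum : ∑ r ∈ RT, ∑ k ∈ K, (4 * (Fr r) 2 * G k / (Real.sqrt 3 * S2) - 1) =
      ∑ k ∈ K, (4 * (∑ r ∈ RT, (Fr r) 2) / (Real.sqrt 3 * S2) * G k - (RT.card : ℝ)) := by
    rw [Finset.sum_comm]
    refine Finset.sum_congr rfl fun k _ => ?_
    rw [Finset.sum_sub_distrib, Finset.sum_const, nsmul_eq_mul, mul_one, Finset.mul_sum, Finset.sum_div, Finset.sum_mul]
    exact congrArg₂ _ (Finset.sum_congr rfl fun r _ => by ring) rfl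
  have hmain := Finset.sum_le_sum hroot
  rw [hsum] at hmain
  push_cast
  refine le_trans (le_of_eq ?_) hmain
  rw [hK, Finset.sum_filter]
  refine Finset.sum_congr rfl fun k _ => ?_
  split_ifs
  · rw [zero_mul]
  · rw [one_mul, hG]

open scoped Classical in
/-- **(I3) B-EXITS FROM ABOVE.**  See the module docstring. -/
theorem oneFcc_exitB_le {σ₁ : ℤ → ℤ} (L' : E3 ≃ₗᵢ[ℝ] E3) (s' : E3) (FrB : E3 ≃ₗᵢ[ℝ] E3)
    (hFrBr : ∀ r : E3, r 2 = 0 → FrB r = -L' r) (t : ℤ)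
    (X' : Finset E3) (R₀ h ρ : ℝ) (hρ : 6 ≤ ρ)
    (hX' : ∀ p ∈ X', ∀ q ∈ X', p ≠ q → 1 ≤ dist p q)
    (Kw : Finset ℤ) (hKw : ∀ k i j : ℤ, L' (barlowPos 1 (Real.sqrt (2 / 3)) σ₁ k i j) + s' ∈ X' → k ∈ Kw) :
    ((∑ r ∈ inPlaneRoots FrB 1,
        (X'.filter fun b => h + (R₀ + 1) + 1 ≤ b 2 ∧ b 2 ≤ h + (R₀ + 1) + 1 + 1 ∧ b 0 ^ 2 + b 1 ^ 2 ≤ (ρ - 1 - 2) ^ 2 ∧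
          (b - FrB r) 2 < h + (R₀ + 1) + 1 ∧
          ∃ k i j : ℤ, b = L' (barlowPos 1 (Real.sqrt (2 / 3)) σ₁ k i j) + s' ∧ ¬ (σ₁ (k - 1) = t ∧ σ₁ k = t)).card : ℕ) : ℝ) ≤
      ∑ k ∈ Kw, (if ¬ (σ₁ (k - 1) = t ∧ σ₁ k = t) then (1 : ℝ) else 0) *
        (4 * (∑ r ∈ inPlaneRoots FrB 1, (FrB r) 2) / (Real.sqrt 3 * (1 - (L'.symm (EuclideanSpace.single (2 : Fin 3) (1 : ℝ))) 2 ^ 2)) *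
          Real.sqrt (max 0 ((ρ - 5 + 1) ^ 2 * (1 - (L'.symm (EuclideanSpace.single (2 : Fin 3) (1 : ℝ))) 2 ^ 2) -
            ((k : ℝ) * Real.sqrt (2 / 3) + (L'.symm s') 2 -
              (h + (R₀ + 1) + 1) * (L'.symm (EuclideanSpace.single (2 : Fin 3) (1 : ℝ))) 2) ^ 2)) +
          ((inPlaneRoots FrB 1).card : ℝ)) +
      ((inPlaneRoots FrB 1).card : ℝ) * (144 * ρ) := by
  set RT := inPlaneRoots FrB 1 with hRTdef
  set ν₂ : ℝ := (L'.symm (EuclideanSpace.single (2 : Fin 3) (1 : ℝ))) 2 with hν₂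
  set S2 : ℝ := 1 - ν₂ ^ 2 with hS2
  set z₁ : ℝ := h + (R₀ + 1) + 1 with hz₁
  set K := Kw.filter (fun k => ¬ (σ₁ (k - 1) = t ∧ σ₁ k = t)) with hK
  set G : ℤ → ℝ := fun k => Real.sqrt (max 0 ((ρ - 5 + 1) ^ 2 * S2 - ((k : ℝ) * Real.sqrt (2 / 3) + (L'.symm s') 2 - z₁ * ν₂) ^ 2))
    with hG
  set ANN := X'.filter (fun b => z₁ ≤ b 2 ∧ b 2 ≤ z₁ + 1 ∧ (ρ - 5) ^ 2 < b 0 ^ 2 + b 1 ^ 2 ∧ b 0 ^ 2 + b 1 ^ 2 ≤ (ρ - 1 - 2) ^ 2)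
    with hANN
  have hRT : ∀ r ∈ RT, -r ∈ fccSlots ∧ (-r) 2 = 0 ∧ 0 < (L' (-r)) 2 ∧ FrB r = L' (-r) := by
    intro r hr
    obtain ⟨hrS, hr2, hup⟩ := mem_filter.1 hr
    have hF : FrB r = L' (-r) := by rw [map_neg, hFrBr r hr2]
    rw [one_mul, hF] at hup
    exact ⟨neg_mem_fccSlots hrS, by rw [PiLp.neg_apply, hr2, neg_zero], hup, hF⟩
  -- the lateral annulus
  have hann : (ANN.card : ℝ) ≤ 144 * ρ := by
    have hsep : ∀ p ∈ ANN, ∀ q ∈ ANN, p ≠ q → 1 ≤ dist p q :=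
      fun p hp q hq hpq => hX' p (mem_filter.1 hp).1 q (mem_filter.1 hq).1 hpq
    have hmem : ∀ p ∈ ANN, z₁ ≤ p 2 ∧ p 2 ≤ z₁ + 1 ∧ (ρ - 5) ^ 2 < p 0 ^ 2 + p 1 ^ 2 ∧ p 0 ^ 2 + p 1 ^ 2 ≤ (ρ - 1 - 2) ^ 2 :=
      fun p hp => (mem_filter.1 hp).2
    have key := card_mul_le_of_separated_in_shell ANN hsep z₁ (z₁ + 1) (ρ - 5) (ρ - 1 - 2) (by linarith) (by linarith)
      (by linarith) hmem
    have e : (z₁ + 1 - z₁ + 2) * (Real.pi * (ρ - 1 - 2 + 1) ^ 2 - Real.pi * (ρ - 5 - 1) ^ 2) = (Real.pi / 6) * (144 * ρ - 576) := by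
      ring
    rw [e] at key
    have hπ : 0 < Real.pi / 6 := by positivity
    have := le_of_mul_le_mul_right (by linarith [key] : (ANN.card : ℝ) * (Real.pi / 6) ≤ (144 * ρ - 576) * (Real.pi / 6)) hπ
    linarith
  -- per root: the first balls above, inside lateral radius `ρ − 5`, plus the annulus
  have hroot : ∀ r ∈ RT,
      ((X'.filter fun b => h + (R₀ + 1) + 1 ≤ b 2 ∧ b 2 ≤ h + (R₀ + 1) + 1 + 1 ∧ b 0 ^ 2 + b 1 ^ 2 ≤ (ρ - 1 - 2) ^ 2 ∧
          (b - FrB r) 2 < h + (R₀ + 1) + 1 ∧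
          ∃ k i j : ℤ, b = L' (barlowPos 1 (Real.sqrt (2 / 3)) σ₁ k i j) + s' ∧ ¬ (σ₁ (k - 1) = t ∧ σ₁ k = t)).card : ℝ) ≤
        ∑ k ∈ K, (4 * (FrB r) 2 * G k / (Real.sqrt 3 * S2) + 1) + (ANN.card : ℝ) := by
    intro r hr
    obtain ⟨hrS, hr2, ha, hF⟩ := hRT r hr
    set EXIT := X'.filter (fun b => h + (R₀ + 1) + 1 ≤ b 2 ∧ b 2 ≤ h + (R₀ + 1) + 1 + 1 ∧ b 0 ^ 2 + b 1 ^ 2 ≤ (ρ - 1 - 2) ^ 2 ∧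
        (b - FrB r) 2 < h + (R₀ + 1) + 1 ∧
        ∃ k i j : ℤ, b = L' (barlowPos 1 (Real.sqrt (2 / 3)) σ₁ k i j) + s' ∧ ¬ (σ₁ (k - 1) = t ∧ σ₁ k = t)) with hEXIT
    set EXITin := EXIT.filter (fun b => b 0 ^ 2 + b 1 ^ 2 ≤ (ρ - 5) ^ 2) with hEXITin
    have hsplit : EXIT ⊆ EXITin ∪ ANN := by
      intro b hb
      rw [mem_union]
      by_cases hin : b 0 ^ 2 + b 1 ^ 2 ≤ (ρ - 5) ^ 2
      · exact Or.inl (mem_filter.2 ⟨hb, hin⟩)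
      · push Not at hin
        obtain ⟨hbX, h1, h2, h3, -, -⟩ := mem_filter.1 hb
        exact Or.inr (mem_filter.2 ⟨hbX, h1, h2, hin, h3⟩)
    have hin : (EXITin.card : ℝ) ≤ ∑ k ∈ K, (4 * (FrB r) 2 * G k / (Real.sqrt 3 * S2) + 1) := by
      have hQ : ∀ b ∈ EXITin, (∃ k ∈ K, ∃ i j : ℤ, b = L' (barlowPos 1 (Real.sqrt (2 / 3)) σ₁ k i j) + s') ∧ z₁ ≤ b 2 ∧
          (b - L' (-r)) 2 < z₁ ∧ b 0 ^ 2 + b 1 ^ 2 ≤ (ρ - 5) ^ 2 := by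
        intro b hb
        obtain ⟨hbE, hlat⟩ := mem_filter.1 hb
        obtain ⟨hbX, h1, -, -, hpred, k, i, j, hbk, htype⟩ := mem_filter.1 hbE
        refine ⟨⟨k, mem_filter.2 ⟨hKw k i j (hbk ▸ hbX), htype⟩, i, j, hbk⟩, h1, by rw [← hF]; exact hpred, hlat⟩
      have h := plate_firstAbove_le σ₁ L' s' hrS hr2 ha z₁ (ρ - 5) (by linarith) K EXITin hQ
      refine h.trans (le_of_eq (Finset.sum_congr rfl fun k _ => by rw [hF]))
    have h1 := card_le_card hsplit
    have h2 := card_union_le EXITin ANN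
    have h3 : (EXIT.card : ℝ) ≤ (EXITin.card : ℝ) + ANN.card := by exact_mod_cast h1.trans h2
    linarith
  -- sum over the roots, exchange, collect
  have hsum : ∑ r ∈ RT, (∑ k ∈ K, (4 * (FrB r) 2 * G k / (Real.sqrt 3 * S2) + 1) + (ANN.card : ℝ)) =
      ∑ k ∈ K, (4 * (∑ r ∈ RT, (FrB r) 2) / (Real.sqrt 3 * S2) * G k + (RT.card : ℝ)) + (RT.card : ℝ) * ANN.card := by
    rw [Finset.sum_add_distrib, Finset.sum_const, nsmul_eq_mul, Finset.sum_comm]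
    congr 1
    refine Finset.sum_congr rfl fun k _ => ?_
    rw [Finset.sum_add_distrib, Finset.sum_const, nsmul_eq_mul, mul_one, Finset.mul_sum, Finset.sum_div, Finset.sum_mul]
    exact congrArg₂ _ (Finset.sum_congr rfl fun r _ => by ring) rfl
  have hmain := Finset.sum_le_sum hroot
  rw [hsum] at hmain
  push_cast
  refine hmain.trans ?_
  have hRT0 : (0 : ℝ) ≤ (RT.card : ℝ) := Nat.cast_nonneg _
  have hlast : (RT.card : ℝ) * ANN.card ≤ (RT.card : ℝ) * (144 * ρ) := mul_le_mul_of_nonneg_left hann hRT0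
  refine add_le_add (le_of_eq ?_) hlast
  rw [hK, Finset.sum_filter]
  refine Finset.sum_congr rfl fun k _ => ?_
  split_ifs
  · rw [zero_mul]
  · rw [one_mul, hG]

end Summit.Ventures.Crystal3D.Theorems

end
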